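import Literature.NumberTheory.NumberFields.NonsolvableGaloisOverNumberFields
import Literature.NumberTheory.NumberFields.PrimeDegreeSymmetricGalois
import Mathlib.FieldTheory.AbelRuffini
import Mathlib.FieldTheory.PrimitiveElement
import Mathlib.FieldTheory.KrullTopology
import HarnessLib

/-!
# The absolute Galois group of a number field is not solvable

Topic `Literature/NumberTheory/NumberFields`.  Theorem-only file (no definition, no named fact),
classical, unconditional; Mathlib vocabulary (`NumberField`, `Polynomial.Gal`, `IsGalois`,
`IsSolvable`, `Field.absoluteGaloisGroup`, `IntermediateField`).

**Theorem.**  Let `F` be a number field.  Then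

* `exists_gal_not_isSolvable`: some monic separable `q ∈ F[X]` has non-solvable Galois group
  `Gal(q)` (= the group of its splitting field over `F`);
* `exists_isGalois_not_isSolvable`: inside an algebraic closure `F̄` there is a finite Galois
  extension `E/F` whose Galois group `Gal(E/F)` is not solvable — equivalently `E ⊄ F^{sol}`,
  i.e. the maximal prosolvable quotient of `Gal(F̄/F)` is a PROPER quotient ("`Gal(F̄/F)` is not
  prosolvable", "`F̄ ≠ F^{sol}`");
* `absoluteGaloisGroup_not_isSolvable`: `Gal(F̄/F)` is not solvable as an abstract group;
* `exists_not_mem_solvableByRad`: **Abel–Ruffini over `F`** — some element of `F̄` is not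
  expressible by radicals over `F` (Mathlib's `solvableByRad`), via a primitive element of `E`.

Proof: take a prime `p > max(4, [F:ℚ])` and the `S_p`-polynomial `f ∈ ℚ[X]` of
`PrimeDegreeSymmetricGalois.lean` (`exists_irreducible_galActionHom_bijective`); by the transfer
theorem of `NonsolvableGaloisOverNumberFields.lean`
(`not_isSolvable_gal_map_of_galActionHom_bijective`: the image of `Gal(f F/F)` in `S_p` has
index `≤ [F:ℚ] < p`, hence contains `A_p`) the Galois group of `f` over `F` is not solvable.

This is the classical input "`F^{sol} ≠ F̄`" / "`G_F` is not prosolvable" used, e.g., in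
[IUTchI] Rmk 3.1.7 (ii)–(iii) (the `κ`-solvable closure is a proper subfield of `F̄`); nothing
in this file depends on or asserts anything from that corpus.

## References

* N. Jacobson, *Basic Algebra I*, 2nd ed. (1985), §4.10 (polynomials with Galois group `S_p`).
* J. Neukirch, A. Schmidt, K. Wingberg, *Cohomology of Number Fields*, 2nd ed. (2008),
  Ch. IX §4–§5 (the maximal prosolvable quotient `G_F^{sol}`; `F^{sol} ≠ F̄`).
-/

namespace Literature.NumberTheory.NumberFields

open Polynomial

variable (F : Type*) [Field F] [NumberField F]

/-- **A number field has a polynomial with non-solvable Galois group**: for every number field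
`F` there is a monic separable `q ∈ F[X]` (the image of an `S_p`-polynomial over `ℚ` with
`p > [F:ℚ]`, `p ≥ 5` prime) whose Galois group is not solvable. [cite: Jacobson1985, §4.10] -/
theorem exists_gal_not_isSolvable :
    ∃ q : F[X], q.Monic ∧ q.Separable ∧ ¬ IsSolvable q.Gal := by
  obtain ⟨p, hp1, hp2⟩ := Nat.exists_infinite_primes (max 5 (Module.finrank ℚ F + 1))
  have h5 : 5 ≤ p := le_trans (le_max_left _ _) hp1
  have hd : Module.finrank ℚ F < p := lt_of_lt_of_le (Nat.lt_succ_self _)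
    (le_trans (le_max_right _ _) hp1)
  obtain ⟨f, hmon, hirr, hdeg, hbij⟩ :=
    SymmetricGaloisRealization.exists_irreducible_galActionHom_bijective p hp2 h5
  refine ⟨f.map (algebraMap ℚ F), hmon.map _, hirr.separable.map, ?_⟩
  exact not_isSolvable_gal_map_of_galActionHom_bijective F hirr (hdeg ▸ h5) (hdeg ▸ hd) hbij

/-- **The absolute Galois group of a number field is not solvable** (as an abstract group):
`¬ IsSolvable Gal(F̄/F)` for `F̄` an algebraic closure of the number field `F`.
[cite: NeukirchSchmidtWingberg2008, Ch. IX §5] -/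
theorem absoluteGaloisGroup_not_isSolvable : ¬ IsSolvable (Field.absoluteGaloisGroup F) := by
  obtain ⟨q, -, -, hq⟩ := exists_gal_not_isSolvable F
  exact absoluteGaloisGroup_not_isSolvable_of_gal F hq

/-- **`F̄ ≠ F^{sol}` / `Gal(F̄/F)` is not prosolvable**: inside an algebraic closure of the number
field `F` there is a FINITE GALOIS extension `E/F` whose Galois group is not solvable (so `E`
is not contained in any compositum of solvable Galois extensions, and `Gal(F̄/F)` has the
non-solvable finite continuous quotient `Gal(E/F)`).  `E` is the subfield generated by the roots
of the polynomial of `exists_gal_not_isSolvable`. [cite: NeukirchSchmidtWingberg2008, Ch. IX §5] -/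
theorem exists_isGalois_not_isSolvable :
    ∃ E : IntermediateField F (AlgebraicClosure F),
      FiniteDimensional F E ∧ IsGalois F E ∧ ¬ IsSolvable Gal(E/F) := by
  obtain ⟨q, -, hsep, hq⟩ := exists_gal_not_isSolvable F
  set Ω := AlgebraicClosure F
  have hsplit : (q.map (algebraMap F Ω)).Splits := IsAlgClosed.splits _
  set E : IntermediateField F Ω := IntermediateField.adjoin F (q.rootSet Ω) with hE
  haveI hSF : IsSplittingField F E q := IntermediateField.adjoin_rootSet_isSplittingField hsplit
  let e : E ≃ₐ[F] q.SplittingField := IsSplittingField.algEquiv E q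
  haveI : FiniteDimensional F E := LinearEquiv.finiteDimensional e.symm.toLinearEquiv
  haveI : IsGalois F E := IsGalois.of_separable_splitting_field hsep
  refine ⟨E, inferInstance, inferInstance, fun hE' => hq ?_⟩
  exact solvable_of_surjective (f := (e.autCongr : Gal(E/F) ≃* q.Gal).toMonoidHom)
    (by exact e.autCongr.surjective)

/-- **Abel–Ruffini over an arbitrary number field.**  For every number field `F` there is an
element of `F̄` that is not solvable by radicals over `F` (`∉ solvableByRad F F̄`): a primitive
element `θ` of the finite Galois extension `E/F` of `exists_isGalois_not_isSolvable`, whose minimal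
polynomial has `E` as splitting field and hence non-solvable Galois group, while Mathlib's
`isSolvable_gal_of_irreducible` (Abel–Ruffini, one direction) says radicals give solvable groups.
[cite: Jacobson1985, §4.10; Lang2002, Ch. VI §7 Thm 7.2] -/
theorem exists_not_mem_solvableByRad :
    ∃ x : AlgebraicClosure F, x ∉ solvableByRad F (AlgebraicClosure F) := by
  obtain ⟨E, hfd, hgal, hns⟩ := exists_isGalois_not_isSolvable F
  obtain ⟨θ, hθ⟩ := Field.exists_primitive_element F E
  refine ⟨(θ : AlgebraicClosure F), fun hx => hns ?_⟩
  have hθint : IsIntegral F θ := .of_finite F θ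
  set q : F[X] := minpoly F θ with hq
  -- `E` is a splitting field of the minimal polynomial of its primitive element
  haveI : IsSplittingField F E q := by
    refine ⟨Normal.splits inferInstance θ, ?_⟩
    refine eq_top_iff.mpr ?_
    have hθroot : (θ : E) ∈ q.rootSet E :=
      mem_rootSet.mpr ⟨minpoly.ne_zero hθint, minpoly.aeval F θ⟩
    calc (⊤ : Subalgebra F E) = (IntermediateField.adjoin F {θ}).toSubalgebra := by
            rw [hθ, IntermediateField.top_toSubalgebra]
      _ = Algebra.adjoin F {θ} :=
            IntermediateField.adjoin_simple_toSubalgebra_of_isAlgebraic hθint.isAlgebraic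
      _ ≤ Algebra.adjoin F (q.rootSet E) :=
            Algebra.adjoin_mono (Set.singleton_subset_iff.mpr hθroot)
  have q_aeval : aeval (θ : AlgebraicClosure F) q = 0 := by
    rw [show (θ : AlgebraicClosure F) = E.val θ from rfl, aeval_algHom_apply, minpoly.aeval,
      map_zero]
  haveI hsolv : IsSolvable Gal(q.SplittingField/F) :=
    isSolvable_gal_of_irreducible hx (minpoly.irreducible hθint) q_aeval
  let e : E ≃ₐ[F] q.SplittingField := IsSplittingField.algEquiv E q
  exact solvable_of_surjective (f := (e.autCongr.symm : q.Gal ≃* Gal(E/F)).toMonoidHom)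
    (by exact e.autCongr.symm.surjective)

/-- **`Gal(F̄/F)` is not prosolvable (topological-group form).**  For a number field `F` there is
an OPEN NORMAL subgroup `N` of the absolute Galois group `Γ_F = Gal(F̄/F)` (Krull topology) whose
(finite) quotient `Γ_F ⧸ N` is not solvable — namely `N = Gal(F̄/E)`, the kernel of restriction to
the finite Galois extension `E/F` of `exists_isGalois_not_isSolvable`, with `Γ_F ⧸ N ≅ Gal(E/F)`.
(Contrast the tree's `isSolvable_quotient_of_isOpen` for non-archimedean LOCAL fields, whose
absolute Galois groups are prosolvable.) [cite: NeukirchSchmidtWingberg2008, Ch. IX §5] -/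
theorem exists_isOpen_normal_quotient_not_isSolvable :
    ∃ (N : Subgroup (Field.absoluteGaloisGroup F)) (_ : N.Normal),
      IsOpen (N : Set (Field.absoluteGaloisGroup F)) ∧
      ¬ IsSolvable (Field.absoluteGaloisGroup F ⧸ N) := by
  obtain ⟨E, hfd, hgal, hns⟩ := exists_isGalois_not_isSolvable F
  let π : Field.absoluteGaloisGroup F →* Gal(E/F) := AlgEquiv.restrictNormalHom E
  have hπ : Function.Surjective π := AlgEquiv.restrictNormalHom_surjective (AlgebraicClosure F)
  haveI hnormal : π.ker.Normal := MonoidHom.normal_ker π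
  refine ⟨π.ker, hnormal, ?_, ?_⟩
  · have hker : π.ker = E.fixingSubgroup := IntermediateField.restrictNormalHom_ker E
    rw [hker]
    exact E.fixingSubgroup_isOpen
  · intro h
    exact hns (solvable_of_surjective
      (f := (QuotientGroup.quotientKerEquivOfSurjective π hπ).toMonoidHom)
      (by exact MulEquiv.surjective _))

end Literature.NumberTheory.NumberFields
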